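import Literature.MathematicalPhysics.QuantumFieldTheory.Balaban1983to89.B9SectBGFrameV5
import Literature.MathematicalPhysics.QuantumFieldTheory.Balaban1983to89.B9SectBL2GStepAtLettersV2

/-!
# `Balaban1983to89.B9SectBL2GFrameV8` — [B9] Sect. B, THE `L²` LETTERS DICTIONARY OF THE BOND-SECTOR OPERATOR G(U′U) OVER THE BLOCK-CARRIER
# LETTERS, V8: `L2GFrame₈` (= V7 with the `ℓ²` LETTERS `Qb2 Qsb2 F₂2 F₂s2` — volume symmetrized, LOCATED-15 — and the product identity `q2_prod`) and ★★ `stepL2Pos_of_l2GFrame₈` — the six (3.46) members of Theorem 3.3 for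
# G(U′U), kernel-free, at letters an instance over NODE 00's coded carriers can inhabit (pub-ymgap N06 row 13, G side, `L²` member)

T. Bałaban, *Propagators for lattice gauge theories in a background field*, Commun. Math. Phys. **99** (1985) 389–434
[`Balaban1985BackgroundPropagators`, "B9"], Theorem 3.4 p. 400, Sect. B pp. 400–407 ((3.80)–(3.86) p. 407), Theorem 3.3 p. 399, Theorem 3.1 (3.46)
p. 398, (3.77) p. 406; [4] = T. Bałaban, *Propagators and renormalization transformations for lattice gauge theories. II*, Commun. Math. Phys. **96**
(1984) 223–250 [`Balaban1984PropagatorsII`], Lemma 2.1 p. 234, Prop. 2.6 (2.140)–(2.141) p. 247.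

statement-level skeleton of published theorems with citation tags; proofs where landed; nothing here is a claim about the Yang–Mills mass gap

WHY A V8 (seat dag-n06-c gen 14, LOCATED-15).  The sup letters of gen 13's G dictionary put the block volume into `Qsb = Q*·vol∘res` (`Qsb·ab·Qb =
Q*·vol·(w∕vol)·Q`), right for (3.15) in SUP norms; in FLAT block-ℓ² on the fine-bond carrier `Qsb` and `F₂s` have norm `≈ vol(y′)^{1/2}` from a source at a
representative bond — V2–V7's factor-wise ℓ² laws `hQsb2`, `hF₂2`.2 are unsatisfiable at NODE 00.  V8 adds SEPARATE ℓ² letters `Qb2, Qsb2, F₂2, F₂s2` (an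
instance takes `√vol` on both sides) with their factor-wise ℓ² laws, the product identity `q2_prod : Qsb2·ab·Qb2 = Qsb·ab·Qb` and (3.80) `qb2_mul` at them; the
step proof rewrites r06's `deltaA … = D*D + Δ′ + DRD* + Q*aQ` (`B9Eq386Neumann.deltaA`) to the ℓ² letters (`deltaA_q2`) before `thm34_G_l2entries`.

WHY A V7 (seat dag-n06-c gen 14, same session as V6).  V6's `readGL2` returns the six letter majorants at the INPUT rate `δ`.  At NODE 00 the bond
family carries print's orientations only (`∇_U G`, `G∇*_U`, `∇∇G`, `∇G∇*`, `G∇*∇*`); the other orientations the r06 bricks consume (`∀ k l : κ ⊕ κ`, print's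
remark p. 398 «we may always replace ∇_U by ∇*_U») are obtained by the block-ℓ² cross ∕ second-order conversions of `B9Eq38CrossLettersL2` ∕
`B9Eq38SecondOrderCrossL2`, which compose with [4] Lemma 2.1 and the scale transfers of p. 398 and therefore LOSE RATE and need a rate-dependent
M-threshold.  V7 = V6 with the two extra fields `rLG`, `ML2` threaded through `readGL2` and the step proof (call rate below `rLG δ₀`; threshold raised by
`ML2 δ₀`); nothing else changes.

WHY A V6 (seat dag-n06-c gen 14).  The kernel-free `L²` route to the six (3.46) members of G(U′U) was built by this lineage's g4–g6 at the V2 letters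
(`B9SectBL2GStepAtLettersV2.L2GFrame₂ extends GFrame₂`, `B9SectBL2GStepAtLettersV3.L2GFrame₃`): print's p. 407 route summed in block-ℓ²
(`B9Thm34GL2Entries.thm34_G_l2entries`: the six members of ANY two-sided inverse of the concrete Δ_a(U′U) from the (3.85)₂ pieces).  The V2∕V3 letters
cannot be inhabited over NODE 00's coded carriers (LOCATED-10: scalar `C`-carrier; LOCATED-12: `coord_mul`; LOCATED-13: rate-independent reading constant);
gen 13's `GFrame₅` is the repaired G dictionary and gen 14's `H1GFrame₆` ∕ `E4H2GFrame₆` the repaired Hölder dictionaries.  `L2GFrame₈` is the `L²`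
dictionary on the same parent: `GFrame₅` + the `L2GFrame₂` fields, with three re-threadings an instance needs — the reading constant `cLG` is a function
of the rate (as `cRG`), `hQb2`∕`hQsb2` and `writeGL2` are given the regular base (as V4's `hQb`).  The proofs are g6's VERBATIM up to: `entries342_ext_of_gFrame₅`
(GIVEN the Lemma-2.1 datum `(d261, h261)`, v2.1) for the inverse identities, no `coord_mul` rewrite (the product background is literal since V4).

WHAT IS IN THE FILE (0 sorry; standard axioms): `structure L2GFrame₈ … extends GFrame₅` (+ `cLG κQb2 cFb2 abar2 wLG wLGδ`, `hQb2 hQsb2 hF₂2 ha2`,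
`readGL2`, `writeGL2`, DISPLAYED `read377`); ★ `l2GEntries_ext_of_l2GFrame₈`; ★★ `stepL2Pos_of_l2GFrame₈ : L2GFrame₈ … → (d261, h261) → StepL2Pos F.dB … GA`.

HONEST SCOPE.  Hypothesis structure, NOT shown inhabited (instance over NODE 00's coded carriers = this seat's successor files: the block-ℓ² readings of
def-Y's bond letters, the ℓ² transport `FBondY × ι ↔ (κ × SiteY) × ι`, (3.77) in block-ℓ² at the record's letters); ONE printed inequality displayed
(`read377`); nothing of [B9] asserted; N06 NOT discharged; count-neutral; nothing continuum ∕ OS ∕ mass-gap ∕ Clay.  Cell `pub-ymgap` (HUMAN RULING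
D-0062), Track A node N06 [B9], N06-ASSIGNMENT row 13, 2026-08-29.

RELATED IN THE TREE, NOT DUPLICATED: `B9SectBL2GFrameV6`, `B9SectBL2GFrameV7` (byte-stable, superseded for instances), `B9SectBL2GStepAtLettersV2` (`L2GFrame₂`, `l2GEntries_ext_of_l2GFrame₂`, `stepL2Pos_of_l2GFrame₂` — the V2
originals, byte-stable), `B9SectBL2GStepAtLettersV3`, `B9SectBGFrameV5` (`GFrame₅`, `entries342_ext_of_gFrame₅`), `B9Thm34GL2Entries` — USED BY NAME.
-/

noncomputable section

open scoped BigOperators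

namespace Literature.MathematicalPhysics.QuantumFieldTheory.Balaban1983to89.B9SectBL2GFrameV8

open Literature.MathematicalPhysics.QuantumFieldTheory.Balaban1983to89
open Literature.MathematicalPhysics.QuantumFieldTheory.Balaban1983to89.B6RandomWalk (HasMajorant Triangle254 Ineq261)
open Literature.MathematicalPhysics.QuantumFieldTheory.Balaban1983to89.B6RandomWalkL2 (HasL2Majorant hasL2Majorant_mono)
open Literature.MathematicalPhysics.QuantumFieldTheory.Balaban1983to89.B9Thm34Ext (toB6)
open Literature.MathematicalPhysics.QuantumFieldTheory.Balaban1983to89.B9Ineq347 (ScaleTransfer)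
open Literature.MathematicalPhysics.QuantumFieldTheory.Balaban1983to89.B9Eq352DivFormLetters (conj)
open Literature.MathematicalPhysics.QuantumFieldTheory.Balaban1983to89.B9Eq352GradLetters (diffLetter)
open Literature.MathematicalPhysics.QuantumFieldTheory.Balaban1983to89.B9Eq371GradLetters (bT bU)
open Literature.MathematicalPhysics.QuantumFieldTheory.Balaban1983to89.B9FromB6 (EBlock L2Block)
open Literature.MathematicalPhysics.QuantumFieldTheory.Balaban1983to89.B9SectBStepWhole (StepPos StepL2Pos)
open Literature.MathematicalPhysics.QuantumFieldTheory.Balaban1983to89.B9SectBGpStepAtLettersV2 (GpFrame₂)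
open Literature.MathematicalPhysics.QuantumFieldTheory.Balaban1983to89.B9SectBGFrameV5 (GFrame₅ entries342_ext_of_gFrame₅)
open Literature.MathematicalPhysics.QuantumFieldTheory.Balaban1983to89.B9Thm34GFinal (exists_threshold_of_continuousAt)
open Literature.MathematicalPhysics.QuantumFieldTheory.Balaban1983to89.B9Ineq363L2 (hasL2Majorant_rate_mono)
open Literature.MathematicalPhysics.QuantumFieldTheory.Balaban1983to89.B9Ineq385VG (kappa383)
open Literature.MathematicalPhysics.QuantumFieldTheory.Balaban1983to89.B9Thm34GL2Entries (pOneConc thetaGL thetaGR rateG rateG_pos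
  thm34_G_l2entries)

universe u

variable {I : Type} (c35 : ℝ) (geo : I → B9.Geometry) (bg : I → B9.Backgrounds)
  (Gp : ∀ i, B9.KernelFamily (geo i) (bg i))
  {𝔸 : Type u} [NormedRing 𝔸] [NormedAlgebra ℂ 𝔸] [CompleteSpace 𝔸] {ι : Type} [Fintype ι] [DecidableEq ι]
  (b : Module.Basis ι ℝ 𝔸) (κ : Type) [Fintype κ] [LinearOrder κ]
  (S : I → Type) [∀ i, Fintype (S i)] [∀ i, DecidableEq (S i)]
  [∀ i, Fintype (geo i).Site] [∀ i, DecidableEq (geo i).Site] [∀ i, Nonempty (geo i).Site]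
  (P : I → Type) [∀ i, Fintype (P i)] [∀ i, DecidableEq (P i)]

/-- **THE LETTERS DICTIONARY FOR THE `L²` MEMBERS (3.46) OF G(U′U) OVER THE BLOCK-CARRIER LETTERS, VERSION 6** (Theorem 3.4 read for Theorem 3.3's
six `L²` members; p. 407 «convergent in all norms appearing in its formulation»): gen 13's `GFrame₅` (block carrier `P` of the `C`-letters, no `coord_mul`,
`gb_eq_cplx`, rate-dependent sup reading constant `cRG`) plus g6's `L2GFrame₂` fields VERBATIM up to three re-threadings — the `L²` READING of Theorem 3.3 at U
(`readGL2`: the (3.46) block of `GA` ⇒ block-ℓ² majorants of the six bond letters of G(U), RATE-DEPENDENT constant `cLG δ`), the `L²` WRITING at U′U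
(`writeGL2`, now also given the regular base), the block-ℓ² sizes of the (3.80)–(3.83) letters `Q(U), Q*(U), F₂(A), F₂*(A), a` (`hQb2 hQsb2` at regular
bases as V4's `hQb`, `hF₂2 ha2`), and ONE DISPLAYED PRINTED INEQUALITY: (3.77) for the concrete `P₁(A)` in block-ℓ² (`read377`, shape of `L2GFrame₂.read377`;
at the V2∕V3 letters it is g6's theorem `B9SectBL2GStepAtLettersV3.read377_of_l2GFrame₃`).  A hypothesis structure; nothing asserted.
[cite: Balaban1985BackgroundPropagators, Thm 3.4 p.400 + Thm 3.3 p.399 + Thm 3.1 (3.46) p.398 + (3.77) p.406 + (3.80)–(3.86) p.407 + (3.15) p.393 + (3.24) p.394; Balaban1984PropagatorsII, Prop. 2.6 (2.140)–(2.141) p.247] -/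
structure L2GFrame₈ (GA : ∀ i, B9.KernelFamily (geo i) (bg i)) (Cinv : ∀ i, B9.SiteKernel (geo i) (bg i))
    extends GFrame₅ c35 geo bg Gp b κ S P GA Cinv where
  /-- the `L²` reading constant of (3.46) for G, the block-ℓ² constants of `Q(U)`∕`Q*(U)`, of `F₂`∕`F₂*` per `α₁`, of the weight `a`; the writing
  functions. -/
  cLG : ℝ → ℝ
  κQb2 : ℝ
  cFb2 : ℝ
  abar2 : ℝ
  wLG : ℝ → ℝ → ℝ
  wLGδ : ℝ → ℝ
  cLG_pos : ∀ δ : ℝ, 0 < δ → 0 < cLG δ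
  /-- (v7) the OUTPUT RATE of the `L²` reading and its rate-dependent M-THRESHOLD (the cross ∕ second-order orientations of the letters are read with
  [4] Lemma 2.1 and the scale transfers of p. 398 at the input rate). -/
  rLG : ℝ → ℝ
  ML2 : ℝ → ℝ
  rLG_pos : ∀ δ : ℝ, 0 < δ → 0 < rLG δ
  rLG_le : ∀ δ : ℝ, 0 < δ → rLG δ ≤ δ
  /-- (v8) THE `ℓ²` LETTERS OF (3.15)∕(3.80): `Q`, `Q*`, `F₂`, `F₂*` with the block volume SYMMETRIZED (`√vol` on both sides; LOCATED-15: the sup letters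
  `Qsb = Q*·vol`, `F₂s` are not flat-ℓ² bounded), tied to the sup letters by the PRODUCT IDENTITY `Qsb2·ab·Qb2 = Qsb·ab·Qb` (the concrete `Δ_a` uses
  `Q*aQ` only through this product) and by (3.80) at the new letters. -/
  Qb2 : ∀ i, (bg i).Cfg → Module.End ℝ ((κ × S i) × ι → ℝ)
  Qsb2 : ∀ i, (bg i).Cfg → Module.End ℝ ((κ × S i) × ι → ℝ)
  F₂2 : ∀ i, (bg i).Cfg → (bg i).Cfg → Module.End ℝ ((κ × S i) × ι → ℝ)
  F₂s2 : ∀ i, (bg i).Cfg → (bg i).Cfg → Module.End ℝ ((κ × S i) × ι → ℝ)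
  q2_prod : ∀ i (V : (bg i).Cfg), Qsb2 i V * ab i * Qb2 i V = Qsb i V * ab i * Qb i V
  qb2_mul : ∀ i (α₁ : ℝ) (U U' : (bg i).Cfg), 0 < α₁ → (bg i).Cplx337 α₁ U U' →
    Qb2 i ((bg i).mul U' U) = Qb2 i U + F₂2 i U U' ∧ Qsb2 i ((bg i).mul U' U) = Qsb2 i U + F₂s2 i U U'
  κQb2_nonneg : 0 ≤ κQb2
  cFb2_nonneg : 0 ≤ cFb2
  abar2_nonneg : 0 ≤ abar2
  wLG_pos : ∀ B δ : ℝ, 0 ≤ B → 0 < δ → 0 < wLG B δ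
  wLGδ_pos : ∀ δ : ℝ, 0 < δ → 0 < wLGδ δ
  /-- (3.15) in block-ℓ² AT THE `ℓ²` LETTERS (v8): at a regular base, `Qb2`, `Qsb2` have block-ℓ² majorants `κQb2·e^{−δd}` at every rate `0 < δ ≦ δcap`. -/
  hQb2 : ∀ i (α₀ : ℝ) (U : (bg i).Cfg) (δ : ℝ), MInv ≤ (geo i).M → 0 < α₀ → (geo i).M * α₀ ≤ aInv → (bg i).Reg335 c35 α₀ U → 0 < δ → δ ≤ δcap →
    HasL2Majorant (g := toB6 (geo i) (Rr i) (Hp i)) (fun q : (κ × S i) × ι => blk i q.1.2) (Qb2 i U)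
      (fun a a' => κQb2 * Real.exp (-(δ * (geo i).dist a a')))
  hQsb2 : ∀ i (α₀ : ℝ) (U : (bg i).Cfg) (δ : ℝ), MInv ≤ (geo i).M → 0 < α₀ → (geo i).M * α₀ ≤ aInv → (bg i).Reg335 c35 α₀ U → 0 < δ → δ ≤ δcap →
    HasL2Majorant (g := toB6 (geo i) (Rr i) (Hp i)) (fun q : (κ × S i) × ι => blk i q.1.2) (Qsb2 i U)
      (fun a a' => κQb2 * Real.exp (-(δ * (geo i).dist a a')))
  /-- (3.81) in block-ℓ² AT THE `ℓ²` LETTERS (v8): `F₂2`, `F₂s2 ≺₂ cFb2·α₁·e^{−δd}` at every rate `0 < δ ≦ δcap`, on the class (3.37). -/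
  hF₂2 : ∀ i (α₁ : ℝ) (U U' : (bg i).Cfg), 0 < α₁ → (bg i).Cplx337 α₁ U U' → ∀ δ : ℝ, 0 < δ → δ ≤ δcap →
    HasL2Majorant (g := toB6 (geo i) (Rr i) (Hp i)) (fun q : (κ × S i) × ι => blk i q.1.2) (F₂2 i U U')
        (fun a a' => cFb2 * α₁ * Real.exp (-(δ * (geo i).dist a a'))) ∧
      HasL2Majorant (g := toB6 (geo i) (Rr i) (Hp i)) (fun q : (κ × S i) × ι => blk i q.1.2) (F₂s2 i U U')
        (fun a a' => cFb2 * α₁ * Real.exp (-(δ * (geo i).dist a a')))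
  /-- (3.24)∕(3.26) in block-ℓ²: the weight letter `a` is block-diagonal with block-ℓ² norm `≦ abar2·(Lʲη)^{−2}`. -/
  ha2 : ∀ i, HasL2Majorant (g := toB6 (geo i) (Rr i) (Hp i)) (fun q : (κ × S i) × ι => blk i q.1.2) (ab i)
    (fun a a' : (geo i).Site => if a = a' then abar2 * ((geo i).len a ^ 2)⁻¹ else 0)
  /-- READING (3.46) at U (v7: above the rate's threshold `ML2 δ`, OUTPUT RATE `rLG δ ≦ δ`): the `L²` block of `GA` at (B₀, δ) ⇒ block-ℓ² majorants of the six
  bond letters of G(U), every orientation, at (cLG(δ)·B₀, rLG δ). -/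
  readGL2 : ∀ i (α₀ : ℝ) (U : (bg i).Cfg) (B₀ δ : ℝ), MInv ≤ (geo i).M → ML2 δ ≤ (geo i).M → 0 < α₀ → (geo i).M * α₀ ≤ aInv →
    (bg i).Reg335 c35 α₀ U → 0 < B₀ → 0 < δ → L2Block (GA i) B₀ δ U →
    HasL2Majorant (g := toB6 (geo i) (Rr i) (Hp i)) (fun q : (κ × S i) × ι => blk i q.1.2) (Gb i U)
        (fun a a' => cLG δ * B₀ * (geo i).len a ^ 2 * Real.exp (-(rLG δ * (geo i).dist a a'))) ∧
      (∀ k : κ ⊕ κ, HasL2Majorant (g := toB6 (geo i) (Rr i) (Hp i)) (fun q : (κ × S i) × ι => blk i q.1.2)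
        (conj b (diffLetter (bT (T i)) (bU (coord i U)) ((((geo i).eta : ℂ))⁻¹) k) * Gb i U)
        (fun a a' => cLG δ * B₀ * (geo i).len a * Real.exp (-(rLG δ * (geo i).dist a a')))) ∧
      (∀ k : κ ⊕ κ, HasL2Majorant (g := toB6 (geo i) (Rr i) (Hp i)) (fun q : (κ × S i) × ι => blk i q.1.2)
        (Gb i U * conj b (diffLetter (bT (T i)) (bU (coord i U)) ((((geo i).eta : ℂ))⁻¹) k))
        (fun a a' => cLG δ * B₀ * (geo i).len a * Real.exp (-(rLG δ * (geo i).dist a a')))) ∧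
      (∀ k l : κ ⊕ κ, HasL2Majorant (g := toB6 (geo i) (Rr i) (Hp i)) (fun q : (κ × S i) × ι => blk i q.1.2)
        (conj b (diffLetter (bT (T i)) (bU (coord i U)) ((((geo i).eta : ℂ))⁻¹) k) *
          conj b (diffLetter (bT (T i)) (bU (coord i U)) ((((geo i).eta : ℂ))⁻¹) l) * Gb i U)
        (fun a a' => cLG δ * B₀ * 1 * Real.exp (-(rLG δ * (geo i).dist a a')))) ∧
      (∀ k l : κ ⊕ κ, HasL2Majorant (g := toB6 (geo i) (Rr i) (Hp i)) (fun q : (κ × S i) × ι => blk i q.1.2)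
        (conj b (diffLetter (bT (T i)) (bU (coord i U)) ((((geo i).eta : ℂ))⁻¹) k) * Gb i U *
          conj b (diffLetter (bT (T i)) (bU (coord i U)) ((((geo i).eta : ℂ))⁻¹) l))
        (fun a a' => cLG δ * B₀ * 1 * Real.exp (-(rLG δ * (geo i).dist a a')))) ∧
      (∀ k l : κ ⊕ κ, HasL2Majorant (g := toB6 (geo i) (Rr i) (Hp i)) (fun q : (κ × S i) × ι => blk i q.1.2)
        (Gb i U * conj b (diffLetter (bT (T i)) (bU (coord i U)) ((((geo i).eta : ℂ))⁻¹) k) *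
          conj b (diffLetter (bT (T i)) (bU (coord i U)) ((((geo i).eta : ℂ))⁻¹) l))
        (fun a a' => cLG δ * B₀ * 1 * Real.exp (-(rLG δ * (geo i).dist a a'))))
  /-- WRITING (3.46) at U′U: block-ℓ² majorants of the six letters of G(U′U) (difference letters at the real U, the (3.37) correction being the
  instance's, as in `GFrame₅.writeG342`) at (B, δ), the base regular, ⇒ the whole `L²` block of `GA` at U′U with (wLG B δ, wLGδ δ), U′ in (3.37) at α₁ ≦ aW. -/
  writeGL2 : ∀ i (α₀ : ℝ) (U U' : (bg i).Cfg) (α₁ B δ : ℝ), MInv ≤ (geo i).M → 0 < α₀ → (geo i).M * α₀ ≤ aInv → (bg i).Reg335 c35 α₀ U →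
    0 < α₁ → α₁ ≤ aW → (bg i).Cplx337 α₁ U U' → 0 ≤ B → 0 < δ →
    HasL2Majorant (g := toB6 (geo i) (Rr i) (Hp i)) (fun q : (κ × S i) × ι => blk i q.1.2) (Gb i ((bg i).mul U' U))
        (fun a a' => B * (geo i).len a ^ 2 * Real.exp (-(δ * (geo i).dist a a'))) →
    (∀ k : κ ⊕ κ, HasL2Majorant (g := toB6 (geo i) (Rr i) (Hp i)) (fun q : (κ × S i) × ι => blk i q.1.2)
        (conj b (diffLetter (bT (T i)) (bU (coord i U)) ((((geo i).eta : ℂ))⁻¹) k) * Gb i ((bg i).mul U' U))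
        (fun a a' => B * (geo i).len a * Real.exp (-(δ * (geo i).dist a a')))) →
    (∀ k : κ ⊕ κ, HasL2Majorant (g := toB6 (geo i) (Rr i) (Hp i)) (fun q : (κ × S i) × ι => blk i q.1.2)
        (Gb i ((bg i).mul U' U) * conj b (diffLetter (bT (T i)) (bU (coord i U)) ((((geo i).eta : ℂ))⁻¹) k))
        (fun a a' => B * (geo i).len a * Real.exp (-(δ * (geo i).dist a a')))) →
    (∀ k l : κ ⊕ κ, HasL2Majorant (g := toB6 (geo i) (Rr i) (Hp i)) (fun q : (κ × S i) × ι => blk i q.1.2)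
        (conj b (diffLetter (bT (T i)) (bU (coord i U)) ((((geo i).eta : ℂ))⁻¹) k) *
          conj b (diffLetter (bT (T i)) (bU (coord i U)) ((((geo i).eta : ℂ))⁻¹) l) * Gb i ((bg i).mul U' U))
        (fun a a' => B * 1 * Real.exp (-(δ * (geo i).dist a a')))) →
    (∀ k l : κ ⊕ κ, HasL2Majorant (g := toB6 (geo i) (Rr i) (Hp i)) (fun q : (κ × S i) × ι => blk i q.1.2)
        (conj b (diffLetter (bT (T i)) (bU (coord i U)) ((((geo i).eta : ℂ))⁻¹) k) * Gb i ((bg i).mul U' U) *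
          conj b (diffLetter (bT (T i)) (bU (coord i U)) ((((geo i).eta : ℂ))⁻¹) l))
        (fun a a' => B * 1 * Real.exp (-(δ * (geo i).dist a a')))) →
    (∀ k l : κ ⊕ κ, HasL2Majorant (g := toB6 (geo i) (Rr i) (Hp i)) (fun q : (κ × S i) × ι => blk i q.1.2)
        (Gb i ((bg i).mul U' U) * conj b (diffLetter (bT (T i)) (bU (coord i U)) ((((geo i).eta : ℂ))⁻¹) k) *
          conj b (diffLetter (bT (T i)) (bU (coord i U)) ((((geo i).eta : ℂ))⁻¹) l))
        (fun a a' => B * 1 * Real.exp (-(δ * (geo i).dist a a')))) →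
    L2Block (GA i) (wLG B δ) (wLGδ δ) ((bg i).mul U' U)
  /-- DISPLAYED PRINTED INEQUALITY (3.77) p. 406 FOR THE CONCRETE `P₁(A)`, in block-ℓ², in print's shape «|P₁(A)| ≦ O(1)α₁e^{−δd}»: for all input
  constants (B₀, δ₀, B₁, δ₁) > 0 of Theorems 3.1∕3.2 at U there are an M-threshold, an α₁-window, a constant and a rate such that at every
  (3.35)-regular U above the threshold carrying the (3.42), (3.46) blocks of `Gp` and the (3.48) kernel of `Cinv`, and every U′ in (3.37) in the
  window, `pOneConc` at the frame's letters (R-words `G′Q′*C⁻¹Q′G′` at U and at U′U) has the block-ℓ² majorant `κ·α₁·(Lʲη)⁻²·e^{−ρd}`.  NOT a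
  reading: a printed estimate whose block-ℓ² proof from readings is the successor item (module header). -/
  read377 : ∀ (B₀ δ₀ B₁ δ₁ : ℝ), 0 < B₀ → 0 < δ₀ → 0 < B₁ → 0 < δ₁ →
    ∃ M₇ a₇ κ₇ ρ₇ : ℝ, 0 < M₇ ∧ 0 < a₇ ∧ 0 ≤ κ₇ ∧ 0 < ρ₇ ∧
      ∀ i (α₀ : ℝ) (U : (bg i).Cfg), M₇ ≤ (geo i).M → 0 < α₀ → (geo i).M * α₀ ≤ aInv → (bg i).Reg335 c35 α₀ U →
        EBlock (Gp i) B₀ δ₀ U → L2Block (Gp i) B₀ δ₀ U →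
        (∀ y y' : (geo i).Site, |(Cinv i).ker U y y'| ≤
          B₁ * ((geo i).len y) ^ (-(4 : ℝ)) * ((geo i).len y') ^ (-(dB : ℝ)) * Real.exp (-(δ₁ * (geo i).dist y y'))) →
        ∀ (α₁ : ℝ) (U' : (bg i).Cfg), 0 < α₁ → α₁ ≤ a₇ → (bg i).Cplx337 α₁ U U' →
          HasL2Majorant (g := toB6 (geo i) (Rr i) (Hp i)) (fun q : (κ × S i) × ι => blk i q.1.2)
            (pOneConc b (T i) (coord i U) (geo i).eta (expA i U U')
              (Gop i U ∘ₗ Qcs i U ∘ₗ Cop i U ∘ₗ Qc i U ∘ₗ Gop i U)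
              (Gop i ((bg i).mul U' U) ∘ₗ Qcs i ((bg i).mul U' U) ∘ₗ Cop i ((bg i).mul U' U) ∘ₗ Qc i ((bg i).mul U' U) ∘ₗ
                Gop i ((bg i).mul U' U)))
            (fun a a' => κ₇ * α₁ * ((geo i).len a ^ 2)⁻¹ * Real.exp (-(ρ₇ * (geo i).dist a a')))

variable {c35 geo bg Gp b κ S P}

omit [DecidableEq ι] [∀ i, DecidableEq (S i)] [∀ i, Nonempty (geo i).Site] [∀ i, Fintype (P i)] [∀ i, DecidableEq (P i)] in
/-- (v8) the concrete `Δ_a` word is the same at the sup letters and at the `ℓ²` letters (`Δ_a = D*D + Δ′ + DRD* + Q*aQ` uses `Q*, a, Q` only through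
their product; `q2_prod`). [cite: Balaban1985BackgroundPropagators, (3.26) p.395, bookkeeping] -/
theorem L2GFrame₈.deltaA_q2 {GA : ∀ i, B9.KernelFamily (geo i) (bg i)} {Cinv : ∀ i, B9.SiteKernel (geo i) (bg i)}
    (F : L2GFrame₈ c35 geo bg Gp b κ S P GA Cinv) (i : I) (V : (bg i).Cfg) (DsD Δp DRDs : Module.End ℝ ((κ × S i) × ι → ℝ)) :
    B9Eq386Neumann.deltaA DsD Δp DRDs (F.Qsb i V) (F.ab i) (F.Qb i V) = B9Eq386Neumann.deltaA DsD Δp DRDs (F.Qsb2 i V) (F.ab i) (F.Qb2 i V) := by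
  unfold B9Eq386Neumann.deltaA; rw [F.q2_prod]

set_option maxHeartbeats 800000 in
/-- ★ **THE SIX `L²` ENTRIES (3.46) OF G(U′U) AT THE V6 LETTERS, KERNEL-FREE** — g6's `l2GEntries_ext_of_l2GFrame₂` re-parented: for every input
`(B₀, δ₀, B₁, δ₁) > 0` there are an M-threshold, `a₁ > 0`, `B ≧ 0` and a rate `ρ > 0` (ALL BEFORE THE MEMBER) such that at every (3.35)-regular U above
the threshold carrying the (3.42), (3.46) blocks of `Gp` and of `GA` at (B₀, δ₀) and the (3.48) kernel of `Cinv` at (B₁, δ₁), and every U′ in (3.37) at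
`α₁ ≦ a₁`, the six bond letters of G(U′U) carry block-ℓ² majorants at (B, ρ) with the weights `(Lʲη)², Lʲη, Lʲη, 1, 1, 1`.  Proof (verbatim up to the
re-threadings): the (3.77) datum `read377` fixes the call rate `δr = rate(min(δ₀, δ₁, ρ₇))`; the inverse identities of G(U′U) from gen 13's
`B9SectBGFrameV5.entries342_ext_of_gFrame₅` (r06 Blk clause + uniqueness, GIVEN the Lemma-2.1 datum `(d261, h261)`), of G(U) from `reg_ginv`; «for α₁
sufficiently small» = CONTINUITY AT 0 (`exists_threshold_of_continuousAt`); then `B9Thm34GL2Entries.thm34_G_l2entries` at δr on the frame's readings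
(lowered to δr), (3.37)∕(3.35)∕stencil data and the law `qb_mul` (no `coord_mul`: V4's product background `prodCfg (coord U) η (expA U U′)` is literal).
[cite: Balaban1985BackgroundPropagators, Thm 3.4 p.400 + Thm 3.3 p.399 + (3.46) p.398 + (3.82)–(3.86) p.407 + (3.77) p.406 + Thm 3.11 p.416; Balaban1984PropagatorsII, Lemma 2.1 p.234 + Prop. 2.6 (2.140)–(2.141) p.247] -/
theorem l2GEntries_ext_of_l2GFrame₈ {GA : ∀ i, B9.KernelFamily (geo i) (bg i)} {Cinv : ∀ i, B9.SiteKernel (geo i) (bg i)}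
    (F : L2GFrame₈ c35 geo bg Gp b κ S P GA Cinv) (d261 : ℝ → ℕ)
    (h261 : ∀ (i : I) (δ α : ℝ), 0 < δ → δ ≤ F.δcap → 9 / 5000 ≤ α → α < 1 → F.M261 δ ≤ (geo i).M →
      Ineq261 (d261 δ) (toB6 (geo i) (F.Rr i) (F.Hp i)) δ α)
    {B₀ δ₀ B₁ δ₁ : ℝ} (hB₀ : 0 < B₀) (hδ₀ : 0 < δ₀) (hB₁ : 0 < B₁) (hδ₁ : 0 < δ₁) :
    ∃ M₀ a₁ B ρ : ℝ, 0 < M₀ ∧ 0 < a₁ ∧ 0 ≤ B ∧ 0 < ρ ∧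
      ∀ (i : I) (α₀ : ℝ) (U : (bg i).Cfg), M₀ ≤ (geo i).M → 0 < α₀ → (geo i).M * α₀ ≤ F.aInv → (bg i).Reg335 c35 α₀ U →
        EBlock (Gp i) B₀ δ₀ U → L2Block (Gp i) B₀ δ₀ U →
        (∀ y y' : (geo i).Site, |(Cinv i).ker U y y'| ≤
          B₁ * ((geo i).len y) ^ (-(4 : ℝ)) * ((geo i).len y') ^ (-(F.dB : ℝ)) * Real.exp (-(δ₁ * (geo i).dist y y'))) →
        EBlock (GA i) B₀ δ₀ U → L2Block (GA i) B₀ δ₀ U →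
        ∀ (α₁ : ℝ) (U' : (bg i).Cfg), 0 < α₁ → α₁ ≤ a₁ → (bg i).Cplx337 α₁ U U' →
          HasL2Majorant (g := toB6 (geo i) (F.Rr i) (F.Hp i)) (fun q : (κ × S i) × ι => F.blk i q.1.2) (F.Gb i ((bg i).mul U' U))
              (fun a a' => B * (geo i).len a ^ 2 * Real.exp (-(ρ * (geo i).dist a a'))) ∧
            (∀ k : κ ⊕ κ, HasL2Majorant (g := toB6 (geo i) (F.Rr i) (F.Hp i)) (fun q : (κ × S i) × ι => F.blk i q.1.2)
              (conj b (diffLetter (bT (F.T i)) (bU (F.coord i U)) ((((geo i).eta : ℂ))⁻¹) k) * F.Gb i ((bg i).mul U' U))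
              (fun a a' => B * (geo i).len a * Real.exp (-(ρ * (geo i).dist a a')))) ∧
            (∀ k : κ ⊕ κ, HasL2Majorant (g := toB6 (geo i) (F.Rr i) (F.Hp i)) (fun q : (κ × S i) × ι => F.blk i q.1.2)
              (F.Gb i ((bg i).mul U' U) * conj b (diffLetter (bT (F.T i)) (bU (F.coord i U)) ((((geo i).eta : ℂ))⁻¹) k))
              (fun a a' => B * (geo i).len a * Real.exp (-(ρ * (geo i).dist a a')))) ∧
            (∀ k l : κ ⊕ κ, HasL2Majorant (g := toB6 (geo i) (F.Rr i) (F.Hp i)) (fun q : (κ × S i) × ι => F.blk i q.1.2)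
              (conj b (diffLetter (bT (F.T i)) (bU (F.coord i U)) ((((geo i).eta : ℂ))⁻¹) k) *
                conj b (diffLetter (bT (F.T i)) (bU (F.coord i U)) ((((geo i).eta : ℂ))⁻¹) l) * F.Gb i ((bg i).mul U' U))
              (fun a a' => B * 1 * Real.exp (-(ρ * (geo i).dist a a')))) ∧
            (∀ k l : κ ⊕ κ, HasL2Majorant (g := toB6 (geo i) (F.Rr i) (F.Hp i)) (fun q : (κ × S i) × ι => F.blk i q.1.2)
              (conj b (diffLetter (bT (F.T i)) (bU (F.coord i U)) ((((geo i).eta : ℂ))⁻¹) k) * F.Gb i ((bg i).mul U' U) *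
                conj b (diffLetter (bT (F.T i)) (bU (F.coord i U)) ((((geo i).eta : ℂ))⁻¹) l))
              (fun a a' => B * 1 * Real.exp (-(ρ * (geo i).dist a a')))) ∧
            (∀ k l : κ ⊕ κ, HasL2Majorant (g := toB6 (geo i) (F.Rr i) (F.Hp i)) (fun q : (κ × S i) × ι => F.blk i q.1.2)
              (F.Gb i ((bg i).mul U' U) * conj b (diffLetter (bT (F.T i)) (bU (F.coord i U)) ((((geo i).eta : ℂ))⁻¹) k) *
                conj b (diffLetter (bT (F.T i)) (bU (F.coord i U)) ((((geo i).eta : ℂ))⁻¹) l))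
              (fun a a' => B * 1 * Real.exp (-(ρ * (geo i).dist a a')))) := by
  classical
  -- the (3.77) datum (before the member) and the CALL RATE `δr = rate (min (min δ₀ δ₁) ρ₇)`
  obtain ⟨M₇, a₇, κ₇, ρ₇, hM₇, ha₇, hκ₇, hρ₇, H77⟩ := F.read377 B₀ δ₀ B₁ δ₁ hB₀ hδ₀ hB₁ hδ₁
  have hρL : 0 < F.rLG δ₀ := F.rLG_pos δ₀ hδ₀
  have hδin : 0 < min (min (F.rLG δ₀) δ₁) ρ₇ := lt_min (lt_min hρL hδ₁) hρ₇
  set δr : ℝ := F.rate (min (min (F.rLG δ₀) δ₁) ρ₇) with hδr_def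
  have hδr : 0 < δr := F.rate_pos hδin
  have hδrc : δr ≤ F.δcap := F.rate_le_cap _
  have hδrL : δr ≤ F.rLG δ₀ := le_trans (F.rate_le _) (le_trans (min_le_left _ _) (min_le_left _ _))
  have hδr0 : δr ≤ δ₀ := hδrL.trans (F.rLG_le δ₀ hδ₀)
  have hδr7 : δr ≤ ρ₇ := le_trans (F.rate_le _) (min_le_right _ _)
  -- the inverse identities of G(U′U): the (3.42)-core (r06 R1 + uniqueness), constants before the member
  obtain ⟨a₂, ha₂, B₂, -, H42⟩ := entries342_ext_of_gFrame₅ F.toGFrame₅ d261 h261 hB₀ hδ₀ hB₁ hδ₁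
  -- frame-level constants of the call
  set dL : ℕ := d261 δr with hdL
  set Λ : ℝ := F.Λf δr (1 / 100) with hΛ_def
  set Λb : ℝ := F.Λf δr (1 / 100 * (24 / 25)) with hΛb_def
  set Λc : ℝ := F.Λf δr (1 / 100 * (1 - 1 / 100) * (1 - 1 / 100) * (24 / 25)) with hΛc_def
  set BL : ℝ := F.cLG δ₀ * B₀ with hBL_def
  have hBL : 0 < BL := mul_pos (F.cLG_pos δ₀ hδ₀) hB₀
  have hΛ0 : 0 ≤ Λ := zero_le_one.trans (F.Λf_one_le δr _ hδr (by norm_num))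
  have hΛb0 : 0 ≤ Λb := zero_le_one.trans (F.Λf_one_le δr _ hδr (by norm_num))
  have hΛc0 : 0 ≤ Λc := zero_le_one.trans (F.Λf_one_le δr _ hδr (by norm_num))
  have hSb : 0 ≤ ∑ j, ‖b j‖ := Finset.sum_nonneg fun j _ => norm_nonneg _
  -- «for α₁ sufficiently small» (p. 407): the two smallness functions are CONTINUOUS AT `α₁ = 0` and vanish there — no lattice datum enters
  obtain ⟨ε₁, hε₁, hE₁⟩ := exists_threshold_of_continuousAt
    (f := fun α₁ : ℝ => thetaGL (Fintype.card κ) (Fintype.card ι) dL BL F.C₀ F.M₂ (∑ j, ‖b j‖) F.d₀ δr Λ κ₇ F.κQb2 F.cFb2 F.abar2 α₁ *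
      B6.c1 dL (24 / 25 * δr) (1 / 100))
    (by
      unfold thetaGL kappa383 B9Eq382V3Letters.cV0 B9Eq373V3.kΔ B9Eq373V3.kP
      fun_prop (disch := simp))
    (by simp [thetaGL])
  obtain ⟨ε₂, hε₂, hE₂⟩ := exists_threshold_of_continuousAt
    (f := fun α₁ : ℝ => thetaGR (Fintype.card κ) (Fintype.card ι) dL BL F.C₀ F.M₂ (∑ j, ‖b j‖) F.d₀ δr Λ κ₇ F.κQb2 F.cFb2 F.abar2 α₁ *
      B6.c1 dL ((1 - 1 / 100) * (24 / 25 * δr)) (1 / 100))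
    (by
      unfold thetaGR kappa383 B9Eq382V3Letters.cV0 B9Eq373V3.kΔ B9Eq373V3.kP
      fun_prop (disch := simp))
    (by simp [thetaGR])
  -- the output constant (α₁- and member-independent) and rate
  set C0 : ℝ := BL * B6.c1 dL (24 / 25 * δr) (1 / 100) * 2 with hC0
  set C2 : ℝ := BL * Λb * B6.c1 dL ((1 - 1 / 100) * (24 / 25 * δr)) (1 / 100) * 2 * Λc with hC2
  set C4 : ℝ := BL + BL * Λb * Λc * Λ * B6.c1 dL δr (1 / 100) with hC4
  set C5 : ℝ := BL * 1 * B6.c1 dL ((1 - 1 / 100) * (24 / 25 * δr)) (1 / 100) * 2 * 1 with hC5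
  have hc10 : 0 ≤ B6.c1 dL (24 / 25 * δr) (1 / 100) := B6RandomWalk.c1_nonneg _ _ _
  have hc20 : 0 ≤ B6.c1 dL ((1 - 1 / 100) * (24 / 25 * δr)) (1 / 100) := B6RandomWalk.c1_nonneg _ _ _
  have hc40 : 0 ≤ B6.c1 dL δr (1 / 100) := B6RandomWalk.c1_nonneg _ _ _
  have hC00 : 0 ≤ C0 := by positivity
  have hC20 : 0 ≤ C2 := by positivity
  have hC40 : 0 ≤ C4 := by positivity
  have hC50 : 0 ≤ C5 := by positivity
  set B : ℝ := C0 + C2 + C4 + C5 with hB_def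
  have hC0B : C0 ≤ B := by rw [hB_def]; linarith
  have hC2B : C2 ≤ B := by rw [hB_def]; linarith
  have hC4B : C4 ≤ B := by rw [hB_def]; linarith
  have hC5B : C5 ≤ B := by rw [hB_def]; linarith
  set a : ℝ := min (min a₂ a₇) (min (1 / 4) (min (ε₁ / 2) (ε₂ / 2))) with ha_def
  have ha0 : 0 < a := lt_min (lt_min ha₂ ha₇) (lt_min (by norm_num) (lt_min (half_pos hε₁) (half_pos hε₂)))
  refine ⟨max (max (max (F.Mthr δr) (F.Mthr (min (min δ₀ δ₁) F.δcap))) M₇) (F.ML2 δ₀), a, B, rateG δr,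
    lt_max_of_lt_left (lt_max_of_lt_left (lt_max_of_lt_left (F.Mthr_pos _))), ha0, by positivity, rateG_pos hδr, ?_⟩
  intro i α₀ U hM0 hα₀ hMa hU hEp hL2p hKer hEG hL2G α₁ U' hα₁ ha hU'
  -- thresholds
  have hM0' := le_trans (le_max_left _ _) hM0
  have hML2 : F.ML2 δ₀ ≤ (geo i).M := le_trans (le_max_right _ _) hM0
  have hMr : F.Mthr δr ≤ (geo i).M := le_trans (le_trans (le_max_left _ _) (le_max_left _ _)) hM0'
  have hM42 : F.Mthr (min (min δ₀ δ₁) F.δcap) ≤ (geo i).M := le_trans (le_trans (le_max_right _ _) (le_max_left _ _)) hM0'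
  have hM7 : M₇ ≤ (geo i).M := le_trans (le_max_right _ _) hM0'
  have hM : F.MInv ≤ (geo i).M := F.MInv_le_of_Mthr_le hMr
  have ha2' : α₁ ≤ a₂ := ha.trans ((min_le_left _ _).trans (min_le_left _ _))
  have ha7' : α₁ ≤ a₇ := ha.trans ((min_le_left _ _).trans (min_le_right _ _))
  have haq : α₁ ≤ 1 / 4 := ha.trans ((min_le_right _ _).trans (min_le_left _ _))
  have haε₁ : α₁ ≤ ε₁ / 2 := ha.trans ((min_le_right _ _).trans ((min_le_right _ _).trans (min_le_left _ _)))
  have haε₂ : α₁ ≤ ε₂ / 2 := ha.trans ((min_le_right _ _).trans ((min_le_right _ _).trans (min_le_right _ _)))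
  have hε₁' : |α₁| < ε₁ := by rw [abs_of_pos hα₁]; linarith
  have hε₂' : |α₁| < ε₂ := by rw [abs_of_pos hα₁]; linarith
  -- the inverse identities of G(U′U) and of G(U); the background of U′U and (3.80)
  obtain ⟨⟨hG1, hG2⟩, -⟩ := H42 i α₀ U hM42 hα₀ hMa hU hEp hKer hEG α₁ U' hα₁ ha2' hU'
  obtain ⟨hΔGb, hGbΔ⟩ := F.deltaA_mul_gb i α₀ U hM hα₀ hMa hU
  obtain ⟨hQbm, hQsbm⟩ := F.qb2_mul i α₁ U U' hα₁ hU'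
  simp only [GFrame₅.DeltaA, GFrame₅.DeltaAprod] at hG1 hG2 hΔGb hGbΔ
  rw [F.deltaA_q2] at hG1 hG2 hΔGb hGbΔ
  -- (3.77) for the concrete P₁(A), lowered to the call rate
  have hw2i : ∀ a : (geo i).Site, 0 ≤ ((geo i).len a ^ 2)⁻¹ := fun a => inv_nonneg.mpr (sq_nonneg _)
  have hP₁ := H77 i α₀ U hM7 hα₀ hMa hU hEp hL2p hKer α₁ U' hα₁ ha7' hU'
  have hP₁' := hasL2Majorant_rate_mono (R := F.Rr i) (H := F.Hp i) (fun q : (κ × S i) × ι => F.blk i q.1.2) (κ₇ * α₁)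
    (fun a => ((geo i).len a ^ 2)⁻¹) (mul_nonneg hκ₇ hα₁.le) hw2i hδr7 (F.dist_nonneg i) hP₁
  -- Theorem 3.3's L² members at U, read and lowered to the call rate
  obtain ⟨l0, l1, l2, l3, l4, l5⟩ := F.readGL2 i α₀ U B₀ δ₀ hM hML2 hα₀ hMa hU hB₀ hδ₀ hL2G
  have hw2 : ∀ a : (geo i).Site, 0 ≤ (geo i).len a ^ 2 := fun a => sq_nonneg _
  have hw1 : ∀ a : (geo i).Site, 0 ≤ (geo i).len a := fun a => (F.len_pos i a).le
  have hw0 : ∀ _a : (geo i).Site, 0 ≤ (1 : ℝ) := fun _ => zero_le_one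
  have l0' := hasL2Majorant_rate_mono (R := F.Rr i) (H := F.Hp i) (fun q : (κ × S i) × ι => F.blk i q.1.2) BL
    (fun a => (geo i).len a ^ 2) hBL.le hw2 hδrL (F.dist_nonneg i) l0
  have l1' := fun k => hasL2Majorant_rate_mono (R := F.Rr i) (H := F.Hp i) (fun q : (κ × S i) × ι => F.blk i q.1.2) BL
    (fun a => (geo i).len a) hBL.le hw1 hδrL (F.dist_nonneg i) (l1 k)
  have l2' := fun k => hasL2Majorant_rate_mono (R := F.Rr i) (H := F.Hp i) (fun q : (κ × S i) × ι => F.blk i q.1.2) BL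
    (fun a => (geo i).len a) hBL.le hw1 hδrL (F.dist_nonneg i) (l2 k)
  have l3' := fun k l => hasL2Majorant_rate_mono (R := F.Rr i) (H := F.Hp i) (fun q : (κ × S i) × ι => F.blk i q.1.2) BL
    (fun _ => (1 : ℝ)) hBL.le hw0 hδrL (F.dist_nonneg i) (l3 k l)
  have l4' := fun k l => hasL2Majorant_rate_mono (R := F.Rr i) (H := F.Hp i) (fun q : (κ × S i) × ι => F.blk i q.1.2) BL
    (fun _ => (1 : ℝ)) hBL.le hw0 hδrL (F.dist_nonneg i) (l4 k l)
  have l5' := fun k l => hasL2Majorant_rate_mono (R := F.Rr i) (H := F.Hp i) (fun q : (κ × S i) × ι => F.blk i q.1.2) BL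
    (fun _ => (1 : ℝ)) hBL.le hw0 hδrL (F.dist_nonneg i) (l5 k l)
  -- the (3.80)–(3.83) letters in block-ℓ² at the call rate
  have hQ := F.hQb2 i α₀ U δr hM hα₀ hMa hU hδr hδrc
  have hQs := F.hQsb2 i α₀ U δr hM hα₀ hMa hU hδr hδrc
  obtain ⟨hF2, hF2s⟩ := F.hF₂2 i α₁ U U' hα₁ hU' δr hδr hδrc
  have hA2 := F.ha2 i
  -- the class (3.37) read blockwise, (3.35) on plaquettes
  obtain ⟨-, -, h337B, h337F, h337Bτ, hA, hAτB⟩ := F.cplx i α₁ U U' hα₁ hU'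
  obtain ⟨h337B', h337FB, hAτF, hAFB, hAst, hAloc, hdAst⟩ := F.cplxG i α₁ U U' hα₁ hU'
  have h35 := F.reg335 i α₀ U hM hα₀ hMa hU
  have hsmall4 : ∀ y : (geo i).Site, (geo i).eta * (α₁ * ((geo i).len y)⁻¹) ≤ 1 / 4 := by
    intro y
    have hl := F.len_pos i y
    have h1 : (geo i).eta * ((geo i).len y)⁻¹ ≤ 1 := by
      rw [← div_eq_mul_inv]; exact (div_le_one hl).mpr (F.eta_le_len i y)
    calc (geo i).eta * (α₁ * ((geo i).len y)⁻¹) = α₁ * ((geo i).eta * ((geo i).len y)⁻¹) := by ring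
      _ ≤ α₁ * 1 := mul_le_mul_of_nonneg_left h1 hα₁.le
      _ ≤ 1 / 4 := by rw [mul_one]; exact haq
  -- [4] Lemma 2.1 at the call rate, uniform in the exponent window
  have h261' : ∀ α : ℝ, 9 / 5000 ≤ α → α < 1 → Ineq261 dL (toB6 (geo i) (F.Rr i) (F.Hp i)) δr α :=
    fun α hα hα1 => h261 i δr α hδr hδrc hα hα1 (F.M261_le_of_Mthr_le hMr)
  have hST : ∀ α : ℝ, 9 / 5000 ≤ α →
      ScaleTransfer (geo i) δr α (F.Λf δr α) (fun a => (geo i).len a) ∧ ScaleTransfer (geo i) δr α (F.Λf δr α) (fun a => (geo i).len a ^ 2) ∧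
      ScaleTransfer (geo i) δr α (F.Λf δr α) (fun a => ((geo i).len a)⁻¹) ∧
      ScaleTransfer (geo i) δr α (F.Λf δr α) (fun a => ((geo i).len a ^ 2)⁻¹) := by
    intro α hα
    obtain ⟨h1, h2, h3, h4, -, -⟩ := F.hST_of i hδr hδrc hMr α hα
    exact ⟨h1, h2, h3, h4⟩
  -- the two smallness conditions at this α₁
  have hsL := (hE₁ α₁ hε₁').le
  have hsR := (hE₂ α₁ hε₂').le
  -- ★ the six L² members of G(U′U) at the letters (`B9Thm34GL2Entries.thm34_G_l2entries` at the call rate)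
  obtain ⟨e0, e1, e2, e3, e4, e5⟩ := thm34_G_l2entries (Rr := F.Rr i) (H := F.Hp i) b (F.T i) (F.coord i U) (F.blk i) dL (F.eta_pos i)
    (F.L_one_le i) (F.expA i U U') F.C₀ F.d₀ F.M₂ δr BL F.κQb2 F.cFb2 F.abar2 κ₇ α₁ (F.Λf δr) hBL.le hα₁.le hδr F.C₀_nonneg F.M₂_nonneg
    F.κQb2_nonneg F.cFb2_nonneg F.abar2_nonneg hκ₇ (fun α hα => F.Λf_one_le δr α hδr hα) F.hrepr (F.dist_nonneg i) (F.triangle i)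
    (F.dist_self i) (F.dist_comm i) (F.len_pos i) h261' hST hsmall4 (F.T_comm i) (F.unitary i U) hA hAτB hAτF hAFB h337B h337F h337B'
    h337Bτ h337FB hAst hAloc hdAst h35 (F.stencilB i) (F.stencilF i) (F.stencilFB i) (F.stencilSt i) (F.stencilLoc i) (F.stencil0 i)
    l0' l1' l2' l3' l4' l5' hQ hQs hF2 hF2s hA2 hQbm hQsbm hP₁' hΔGb hGbΔ hG1 hG2 hsL hsR
  -- weaken the six constants to the common `B`
  have hexp : ∀ a a' : (geo i).Site, 0 ≤ Real.exp (-(rateG δr * (geo i).dist a a')) := fun _ _ => Real.exp_nonneg _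
  refine ⟨?_, fun k => ?_, fun k => ?_, fun k l => ?_, fun k l => ?_, fun k l => ?_⟩
  · exact hasL2Majorant_mono (g := toB6 (geo i) (F.Rr i) (F.Hp i)) _ e0 fun a a' =>
      mul_le_mul_of_nonneg_right (mul_le_mul_of_nonneg_right hC0B (hw2 a)) (hexp a a')
  · exact hasL2Majorant_mono (g := toB6 (geo i) (F.Rr i) (F.Hp i)) _ (e1 k) fun a a' =>
      mul_le_mul_of_nonneg_right (mul_le_mul_of_nonneg_right hC0B (hw1 a)) (hexp a a')
  · exact hasL2Majorant_mono (g := toB6 (geo i) (F.Rr i) (F.Hp i)) _ (e2 k) fun a a' =>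
      mul_le_mul_of_nonneg_right (mul_le_mul_of_nonneg_right hC2B (hw1 a)) (hexp a a')
  · exact hasL2Majorant_mono (g := toB6 (geo i) (F.Rr i) (F.Hp i)) _ (e3 k l) fun a a' =>
      mul_le_mul_of_nonneg_right (mul_le_mul_of_nonneg_right hC0B (hw0 a)) (hexp a a')
  · exact hasL2Majorant_mono (g := toB6 (geo i) (F.Rr i) (F.Hp i)) _ (e4 k l) fun a a' =>
      mul_le_mul_of_nonneg_right (mul_le_mul_of_nonneg_right hC4B (hw0 a)) (hexp a a')
  · exact hasL2Majorant_mono (g := toB6 (geo i) (F.Rr i) (F.Hp i)) _ (e5 k l) fun a a' =>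
      mul_le_mul_of_nonneg_right (mul_le_mul_of_nonneg_right hC5B (hw0 a)) (hexp a a')

/-- ★★ **THE (3.46)-STEP OF SECT. B FOR THE BOND-SECTOR OPERATOR G(U′U), INHABITED AT THE V6 LETTERS, KERNEL-FREE**: every `L2GFrame₈` with a
Lemma-2.1 datum `(d261, h261)` inhabits the positive-input block-step `B9SectBStepWhole.StepL2Pos F.dB c35 geo bg Gp GA Cinv GA` — all six `L²` members
(3.46) of Theorem 3.3 for G(U′U) at once (output `(wLG B ρ, wLGδ ρ)`, `ρ = rateG δr`), by `l2GEntries_ext_of_l2GFrame₈` and the frame's `L²` writing;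
ONE displayed printed inequality ((3.77) in block-ℓ², field `read377`).  The frame is NOT shown inhabited here (instance = gen 14's successor file over
NODE 00's coded carriers). [cite: Balaban1985BackgroundPropagators, Thm 3.4 p.400 + Thm 3.3 p.399 + Thm 3.1 (3.46) p.398 + (3.82)–(3.86) p.407; Balaban1984PropagatorsII, Prop. 2.6 (2.140)–(2.141) p.247 + Lemma 2.1 p.234] -/
theorem stepL2Pos_of_l2GFrame₈ {GA : ∀ i, B9.KernelFamily (geo i) (bg i)} {Cinv : ∀ i, B9.SiteKernel (geo i) (bg i)}
    (F : L2GFrame₈ c35 geo bg Gp b κ S P GA Cinv) (d261 : ℝ → ℕ)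
    (h261 : ∀ (i : I) (δ α : ℝ), 0 < δ → δ ≤ F.δcap → 9 / 5000 ≤ α → α < 1 → F.M261 δ ≤ (geo i).M →
      Ineq261 (d261 δ) (toB6 (geo i) (F.Rr i) (F.Hp i)) δ α) :
    StepL2Pos F.dB c35 geo bg Gp GA Cinv GA := by
  intro B₀ δ₀ Bβ Bε Bεβ B₁ δ₁ hB₀ hδ₀ hB₁ hδ₁
  obtain ⟨M₀, a₁, B, ρ, hM₀, ha₁, hB, hρ, Hc⟩ := l2GEntries_ext_of_l2GFrame₈ F d261 h261 hB₀ hδ₀ hB₁ hδ₁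
  refine ⟨max M₀ F.MInv, min a₁ F.aW, F.aInv, (F.wLG B ρ, F.wLGδ ρ), lt_max_of_lt_left hM₀, lt_min ha₁ F.aW_pos, F.aInv_pos,
    ⟨F.wLG_pos B ρ hB hρ, F.wLGδ_pos ρ hρ⟩, ?_⟩
  intro i hM α₀ hα₀ hMa U hU hT α₁ hα₁ ha U' hU'
  have hM0 : M₀ ≤ (geo i).M := le_trans (le_max_left _ _) hM
  have hMI : F.MInv ≤ (geo i).M := le_trans (le_max_right _ _) hM
  obtain ⟨e0, e1, e2, e3, e4, e5⟩ := Hc i α₀ U hM0 hα₀ hMa hU hT.1.1.1 hT.1.1.2.1 hT.2.1 hT.2.2.1.1 hT.2.2.1.2.1 α₁ U' hα₁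
    (le_trans ha (min_le_left _ _)) hU'
  exact F.writeGL2 i α₀ U U' α₁ B ρ hMI hα₀ hMa hU hα₁ (le_trans ha (min_le_right _ _)) hU' hB hρ e0 e1 e2 e3 e4 e5

end Literature.MathematicalPhysics.QuantumFieldTheory.Balaban1983to89.B9SectBL2GFrameV8
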